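import Mathlib
import Literature.Computability.Complexity.GraphEncodings
import Literature.Computability.Complexity.GraphCanonization
import Literature.Computability.Complexity.KarpChromaticMachine
import Summits.PneNP.PneNP.Theorems.SymmetryBudgetWindowBarrierGraphBridge
import Summits.PneNP.PneNP.Theorems.SymmetryBudgetWindowBarrierTwinIsoBricks
import Summits.PneNP.PneNP.Theorems.SymmetryBudgetWindowBarrierTwinIsoBridge

/-!
# Stub `stub_twinIsoInP_of_canonicalForm` of line `bijection-gauge-twin-iso` for crux
`SymmetryBudget.WindowBarrier` (item stmt-PneNP-2145, route route-PneNP-SymmetryBudget)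

**From canonical forms of small vertex-coloured graphs to TWIN ISOMORPHISM in `P`.** Hypothesis
(Babai–Luks 1983, the body of the tree's named fact `babaiLuks1983_canonicalForm`): a string map
`can ∈ FTIME (N ↦ 2^{c√N})` which is a canonical form on the codes `⟨encodingGraph-code, encodingFinVec-code⟩`
of vertex-coloured graphs. Conclusion: some `L ∈ P` contains the code of an `m`-vertex graph `G` iff
`G[A] ≃g G[B]`, where `A` / `B` are the free vertices `u` (`m ≤ u + ⌊log₂ m⌋`) adjacent / non-adjacent to
the vertex `0`.

The witness is `L = {w | can (twinCode true w) = can (twinCode false w)}`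
(`SymmetryBudgetWindowBarrierTwinIsoBricks.lean`): on a graph code, `twinCode b` is the code of the TWIN GRAPH
on the `g = ⌊log₂ m⌋` free vertices (the free graph with the edges between `A` and `B` deleted) coloured by
"`1` on marker `b`" (`twinCode_codeOf`, this file: the marker bits `mkOf`, the masked block `twinMaskFn` and the
colour list `chiFn` read on `encodingGraph.encode ⟨m, G⟩`). `L ∈ P`: `can ∘ twinCode b ∈ FP` because the
twin code has length `≤ (3 (log₂|w| + 1))²` (`can_twinCode_mem_FP`) and equality of two `FP` maps is
decidable in `P` (`setOf_apply_eq_apply_mem_P`). Correctness: by completeness of canonical forms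
(`babaiLuks1983_canonicalForm.complete`) membership says that the two coloured twin graphs are
colour-isomorphic, i.e. that the twin graph has a colour-SWAPPING automorphism, which is exactly an
isomorphism `G[A] ≃g G[B]` glued with its inverse (`TwinIso.twinIso_iff`,
`SymmetryBudgetWindowBarrierTwinIsoBridge.lean`). Degenerate `m ≤ 1`: `g = 0`, both sides hold.
-/

-- `Summit.PneNP.PneNP.…` duplicates `PneNP` BY DESIGN (single-problem summit).
set_option linter.dupNamespace false

namespace Summit.PneNP.PneNP.Theorems.TwinIso

open Literature.Computability.Complexity Brick Plumb UnaryOffsets CompleteInvariant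
open _root_.Computability Polynomial
open scoped Classical

variable {m : ℕ}

/-! ### The twin code on graph codes -/

/-- **The marker bit on a code**: `mkOf (code G) j = [fre j ∈ marked G]` (bit `(0, n + j)` of the
adjacency matrix; vacuous for `m = 0`). -/
theorem mkOf_codeOf (G : SimpleGraph (Fin m)) (j : Fin (gg m)) : mkOf (codeOf G) j = decide (fre m j ∈ marked G) := by
  unfold mkOf
  rw [sndF_codeOf, unN_codeOf]
  simp only [ones, List.length_replicate]
  rcases Nat.eq_zero_or_pos m with hm | hm
  · subst hm
    exact absurd j.2 (by simp)
  · have h := getD_adjOf G ⟨0, hm⟩ (fre m j)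
    rw [fre_val, zero_mul, zero_add] at h
    rw [h]
    exact Bool.decide_congr ⟨fun a => ⟨hm, a⟩, fun ⟨_, a⟩ => a⟩

/-- **The masked bit on a code** is the adjacency bit of the twin graph. -/
theorem twinMaskOf_codeOf (G : SimpleGraph (Fin m)) (t c : Fin (gg m)) :
    twinMaskOf (codeOf G) t c = decide ((twinG G).Adj t c) := by
  have h := getD_adjOf G (fre m t) (fre m c)
  have e : (fre m t : ℕ) * m + (fre m c : ℕ) = (nn m + t) * m + nn m + c := by
    rw [fre_val, fre_val, Nat.add_assoc]
  unfold twinMaskOf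
  rw [mkOf_codeOf, mkOf_codeOf, sndF_codeOf, unN_codeOf, unM_codeOf]
  simp only [ones, List.length_replicate]
  rw [← e, h, Bool.eq_iff_iff]
  simp [twinG_adj]

/-- **The masked block on a code is the adjacency string of the twin graph.** -/
theorem twinMaskFn_codeOf (G : SimpleGraph (Fin m)) : twinMaskFn (codeOf G) = adjOf (twinG G) := by
  rw [twinMaskFn_apply, unG_codeOf]
  simp only [ones, List.length_replicate]
  rw [adjOf_eq_flatten (twinG G), KarpChromatic.ccat_eq_flatten_ofFn]
  refine congrArg List.flatten (List.ofFn_inj.2 (funext fun t => ?_))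
  rw [ccat_singleton]
  exact List.ofFn_inj.2 (funext fun c => twinMaskOf_codeOf G t c)

/-- **The colour list on a code is the `encodingFinVec` code of the marker colouring.** -/
theorem chiFn_codeOf (b : Bool) (G : SimpleGraph (Fin m)) :
    boolPair (ones (gg m)) (chiFn b (codeOf G)) = (encodingFinVec encodingNatBool (gg m)).encode (chi b G) := by
  rw [chiFn_apply, unG_codeOf]
  simp only [ones, List.length_replicate]
  rw [finVec_encode_eq, ← boolPair_eq, unaryEncodeNat_eq_replicate, encList_eq_frames, map_range_eq_ofFn]
  simp only [chiVal, mkOf_codeOf]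
  rfl

/-- **The twin code on a graph code is the code of the coloured twin graph**, in the format of the
canonical-form hypothesis (`colGraphCode`). -/
theorem twinCode_codeOf (b : Bool) (G : SimpleGraph (Fin m)) :
    twinCode b (codeOf G) = colGraphCode (gg m) (twinG G) (chi b G) := by
  rw [colGraphCode, twinCode_apply, twinMaskFn_codeOf, ← chiFn_codeOf, unG_codeOf, encodingGraph_encode]
  simp only [ones, List.length_replicate]

/-- **Membership of a graph code in the twin language is twin isomorphism**, for every map `can` that is a
complete invariant of colour-isomorphism on codes of coloured graphs. -/
theorem can_twinCode_eq_iff {can : List Bool → List Bool}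
    (hiff : ∀ (k : ℕ) (G₁ : SimpleGraph (Fin k)) (c₁ : Fin k → ℕ) (G₂ : SimpleGraph (Fin k)) (c₂ : Fin k → ℕ),
      can (colGraphCode k G₁ c₁) = can (colGraphCode k G₂ c₂) ↔ ColIso k G₁ c₁ G₂ c₂)
    (G : SimpleGraph (Fin m)) :
    can (twinCode true (codeOf G)) = can (twinCode false (codeOf G)) ↔
      Nonempty
        (SimpleGraph.induce {u : Fin m | m ≤ (u : ℕ) + Nat.log 2 m ∧ ∃ h : 0 < m, G.Adj ⟨0, h⟩ u} G ≃g
          SimpleGraph.induce {u : Fin m | m ≤ (u : ℕ) + Nat.log 2 m ∧ ¬ ∃ h : 0 < m, G.Adj ⟨0, h⟩ u} G) := by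
  rw [twinCode_codeOf, twinCode_codeOf, hiff, twinIso_iff]

end Summit.PneNP.PneNP.Theorems.TwinIso

namespace Summit.PneNP.PneNP.Theorems

open Literature.Computability.Complexity Filter TwinIso CompleteInvariant
open _root_.Computability
open scoped Classical

/-- **S_P — from canonical forms of small coloured graphs to twin isomorphism in `P`.** Given a canoniser
`can ∈ FTIME (N ↦ 2^{c√N})` of vertex-coloured graphs (canonical form colour-isomorphic to the input, equal on
colour-isomorphic inputs), the language `{w | can (twinCode true w) = can (twinCode false w)}` is in `P` and
contains the code of an `m`-vertex graph `G` iff `G[A] ≃g G[B]`, `A` / `B` the free vertices adjacent /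
non-adjacent to vertex `0`. -/
theorem stub_twinIsoInP_of_canonicalForm :
    (∃ c : ℕ, ∃ can ∈ FTIME (fun N => 2 ^ (c * Nat.sqrt N)),
      (∀ (k : ℕ) (G : SimpleGraph (Fin k)) (col : Fin k → ℕ),
          ∃ (G' : SimpleGraph (Fin k)) (col' : Fin k → ℕ),
            can (boolPair (encodingGraph.encode ⟨k, G⟩)
                  ((encodingFinVec Computability.encodingNatBool k).encode col)) =
                boolPair (encodingGraph.encode ⟨k, G'⟩)
                  ((encodingFinVec Computability.encodingNatBool k).encode col') ∧
              ∃ σ : G ≃g G', ∀ v : Fin k, col' (σ v) = col v) ∧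
      ∀ (k : ℕ) (G₁ : SimpleGraph (Fin k)) (c₁ : Fin k → ℕ) (G₂ : SimpleGraph (Fin k))
        (c₂ : Fin k → ℕ), (∃ σ : G₁ ≃g G₂, ∀ v : Fin k, c₂ (σ v) = c₁ v) →
          can (boolPair (encodingGraph.encode ⟨k, G₁⟩)
                ((encodingFinVec Computability.encodingNatBool k).encode c₁)) =
            can (boolPair (encodingGraph.encode ⟨k, G₂⟩)
                ((encodingFinVec Computability.encodingNatBool k).encode c₂))) →
    ∃ L ∈ Classes.P, ∀ (m : ℕ) (G : SimpleGraph (Fin m)),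
      encodingGraph.encode ⟨m, G⟩ ∈ L ↔
        Nonempty
          (SimpleGraph.induce {u : Fin m | m ≤ (u : ℕ) + Nat.log 2 m ∧ ∃ h : 0 < m, G.Adj ⟨0, h⟩ u}
              G ≃g
            SimpleGraph.induce {u : Fin m | m ≤ (u : ℕ) + Nat.log 2 m ∧ ¬ ∃ h : 0 < m, G.Adj ⟨0, h⟩ u}
              G) := by
  intro hBL
  obtain ⟨c, can, hcan, hiff⟩ := babaiLuks1983_canonicalForm.complete hBL
  refine ⟨{w | (can ∘ twinCode true) w = (can ∘ twinCode false) w},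
    setOf_apply_eq_apply_mem_P (can_twinCode_mem_FP true hcan) (can_twinCode_mem_FP false hcan), fun m G => ?_⟩
  exact TwinIso.can_twinCode_eq_iff hiff G

end Summit.PneNP.PneNP.Theorems
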